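import Summits.BirchSwinnertonDyer.BirchSwinnertonDyer.Theorems.SignedLowerHalvesSmallImageLowerHalfBothSignsRttTierUnitClosure
import Summits.BirchSwinnertonDyer.BirchSwinnertonDyer.Theorems.SignedLowerHalvesKobayashiMainConjectureSmallImageUnitPartnerRecordsA
import Summits.BirchSwinnertonDyer.BirchSwinnertonDyer.Theorems.SignedLowerHalvesKobayashiMainConjectureSmallImageUnitPartnerRecordsB
import Summits.BirchSwinnertonDyer.BirchSwinnertonDyer.Theorems.Rank1ResidualIntModelReduction
import Literature.NumberTheory.EllipticCurves.ModThreeImageCubeDiscriminantProofs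
import HarnessLib

/-!
# Route `SignedLowerHalves`, crux L `SmallImageLowerHalfBothSigns` (item stmt-BirchSwinnertonDyer-23599), line `rtt_w3` v4:
# tier-T1u RECORDS, part 02 — `158711b1`, `421645e1` (partner `8477b1`) and the self-unit pair `126350bb1`, all at `p = 3`

Width seat `bsd-line-slh-p3-w3` g13 under LEAD `cruxlead-stmt-BirchSwinnertonDyer-23599` g2 (cell `bsd-ssimc`); `--supports
stmt-BirchSwinnertonDyer-23599 --as helper`; THEOREMS ONLY; PER PAIR; closes nothing class-wide; BSD is proved for no curve (every
published input is a named-fact HYPOTHESIS, and each record displays ONE rational `L`-value datum of the partner).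

WHAT IS NEW. The LEAD's tier T2 («no CM elliptic-curve partner», 57 of the 136 open census pairs) is served class-wide only by the
research stub ENG_T2 (seam (C-S2), unprinted). The unit-curve engine (`…RttEngineUnitCurve`, `…RttTierUnitClosure`, this seat) needs NO
main-conjecture input at the partner, so every T2 pair `(W, 3)` with a `3`-congruent curve `A/ℚ` (good at `3`, `a_3(A) = 0`) whose
`L(A,1)/Ω_A` is a non-zero `3`-adic unit gets crux L's body `∀ ε, KobayashiLowerDivisibility W 3 ε` from ELEVEN published named facts
(Kobayashi `hJ h12 h41`, period units `h5 h3`, Hida/Carayol/Saito `hD hC hS`, modularity `hmod`, B. D. Kim 2009 `hKim`, Vatsal 1999 `hV`;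
NO Pollack–Rubin, NO B. D. Kim 2013, NO descent line, NO `BSD(E,3)`, NO preprint) plus kernel certificates and that one datum.
This file records the SIX such pairs at `p = 3` known from the k3-c4 census (MEMO-5: `4165m1`, `20335g1`, `117355j1`, `158711b1`,
`421645e1` with the unit partner `A = 8477b1` = `[1,−1,0,−338,1357]`, `N_A = 7²·173`, Cremona `allbsd`: rank `0`, `#A(ℚ)_tors = 1`,
`∏c = 2`, `#Ш_an = 1`, so `L(A,1)/Ω_A = 2`; and the self-unit pair `126350bb1` = its own partner, Cremona: `#tors = 2`, `∏c = 16`,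
`#Ш_an = 4`, `L(E,1)/Ω_E = 16`). Kernel-decided per pair: `3 ∤ Δ` and `#Ẽ(𝔽₃) = 4` for both curves (good supersingular, `a_3 = 0`;
the point counts are k3-c4's landed `card_u…_3`), an additive prime of `W` (`7`, resp. `19`: `ℓ ∣ Δ`, `ℓ ∣ c₄` ⇒ X7), `Δ(W)` A RATIONAL
CUBE ⇒ `ρ̄_{W,3}` not onto (`ModThreeImage.not_hasSurjectiveModNGaloisRep_three_of_Δ_eq_cube`, Serre 1972 §5.3), and the `3`-congruence
`W[3] ≃ A[3]` by Fisher's Hesse pencils (k3-c4's certificates `(λ:μ)`, `u` re-checked by `norm_num`). The seventh census unit pair,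
`431433g1 @ 5` (self-unit), waits for a mod-`5` small-image certificate and is not recorded here.

References: [Kobayashi2003] Conjecture (p. 2), (3.6), Thm. 7.4; [Fisher2012Hessian] Thm. 13.2 and §13; [Cremona2006] Table 1
(labels 8477b1, 4165m1, 20335g1, 117355j1, 158711b1, 421645e1, 126350bb1); [Serre1972] §5.3; [SilvermanAEC2009] VII.5 Prop. 5.1;
[BDKim2009] Cor. 2.13; [Vatsal1999] (1.6), (1.13); [GreenbergVatsal2000] §3 Rem. 3.4.
-/

set_option autoImplicit false
-- D-0017: single-problem summit, the namespace repeats the problem name by design.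
set_option linter.dupNamespace false
noncomputable section

open scoped Classical MatrixGroups ModularForm

open CongruenceSubgroup WeierstrassCurve Literature.NumberTheory.EllipticCurves
  Literature.NumberTheory.EllipticCurves.ModularForms
  Literature.NumberTheory.EllipticCurves.Kobayashi2003 ZpExtension
  Literature.NumberTheory.EllipticCurves.GreenbergVatsal2000
  Literature.NumberTheory.EllipticCurves.Rank1Residual
  Literature.NumberTheory.EllipticCurves.Rank1Residual.Typed
  Literature.NumberTheory.EllipticCurves.Rank1Residual.X11RankOneCertificates
  Literature.NumberTheory.EllipticCurves.Fisher2012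
  Summit.BirchSwinnertonDyer.BirchSwinnertonDyer.Rank1Residual.IntModel
  Summit.BirchSwinnertonDyer.BirchSwinnertonDyer.Rank1Residual.X11RankOne
  Summit.BirchSwinnertonDyer.Rank1Residual.X11b
  Summit.BirchSwinnertonDyer.Rank1Residual.X9
  Summit.BirchSwinnertonDyer.Rank1Residual.X1
  Summit.BirchSwinnertonDyer.Rank1Residual.Supersingular

namespace Summit.BirchSwinnertonDyer.BirchSwinnertonDyer.Theorems.SmallImageRttOneSided

/-- **Crux L's body at `158711b1 @ 3` FROM PRINT + ONE `L`-VALUE** (Cremona model `[1, -1, 0, -232717, 2826984]`, `N = 158711 = 7²·41·79`, X7 (additive at `7`),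
`a_3 = 0`, mod-3 image `3Nn` (`Δ` a cube), rank `0`, `∏c = 36`, NO CM elliptic-curve partner — tier T2 of the LEAD's census):
`∀ ε, KobayashiLowerDivisibility W 3 ε` from ELEVEN published named facts by `forall_kobayashiLowerDivisibility_three_of_unitCurvePartner` at
the UNIT partner `A = 8477b1` (`[1, -1, 0, -338, 1357]`, `N_A = 7²·173`, good supersingular at `3`, `a_3 = 0`), whose `L`-value datum
`L(A,1)/Ω_A = 2` (Cremona `allbsd` row `8477 b 1`: rank `0`, `#tors = 1`, `∏c = 2`, `#Ш_an = 1.000`) is the ONE displayed non-kernel input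
(`htA`); the `3`-congruence `W[3] ≃ A[3]` is k3-c4's kernel certificate (member `((1261) / 33)` of Fisher's DUAL Hesse pencil `X_A^-(3)`, scaling
`u = (1) / 693`; `threeCongruent_of_dualHesseCertificate_unconditional`, identity by `norm_num`). Kernel-decided: `3 ∤ Δ` (both), `#Ẽ(𝔽₃) = 4` (both), `7 ∣ Δ, c₄`
(additive ⇒ X7), `Δ(W) = (929593)³` (⇒ `¬ Surj W 3`). NO Pollack–Rubin, NO descent line, NO `BSD(E,3)`, NO preprint. Per pair;
CONDITIONAL on print; nothing booked. [cite: Kobayashi2003, Conjecture (p. 2), (3.6), Thm. 7.4 (p. 13)] [cite: Fisher2012Hessian, Thm. 13.2 and §13]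
[cite: Cremona2006, Table 1 (Cremona labels 158711b1, 8477b1)] [cite: Serre1972, §5.3] [cite: SilvermanAEC2009, VII.5 Prop. 5.1(c)] -/
theorem forall_kobayashiLowerDivisibility_u158711b1_3_of_unitPartner
    (hJ : thm62_63_73_signedColemanKato_zetaJoint) (h12 : thm12_signedSelmerDual_finite_torsion)
    (h41 : thm41_signedCharIdeal_divisibility)
    (h5 : realPeriodRat_eq_unit_mul_plusPeriod) (h3 : realPeriodRat_eq_unit_mul_plusPeriod_three)
    (hD : Hida2000_thm326_exists_galoisRep) (hC : Carayol1986_artinConductorExponent)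
    (hS : ∀ (V : WeierstrassCurve ℚ) (ℓ : ℕ) [Fact ℓ.Prime],
      V.swanConductorAt_rationalTate_eq_wildConductorExponent_of_ringChar_eq_two ℓ)
    (hmod : exists_isNewformOf)
    (hKim : BDKim2009.cor213_signedLambda_add_sum_delta_eq_of_torsionIso) (hV : vatsal1999_plusSymbol_congruence)
    (W A : WeierstrassCurve ℚ) [W.IsElliptic] [W.IsGloballyMinimal] [A.IsElliptic] [A.IsGloballyMinimal]
    [Fact (Nat.Prime 3)] (hW : W = ⟨1, -1, 0, -232717, 2826984⟩) (hA : A = ⟨1, -1, 0, -338, 1357⟩)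
    (htA : A.entireLFunction 1 / (A.realPeriodRat : ℂ) = ((2 : ℚ) : ℂ)) :
    ∀ ε : ℤˣ, KobayashiLowerDivisibility W 3 ε := by
  have hIW : integralModelInt W = ⟨1, -1, 0, -232717, 2826984⟩ :=
    integralModelInt_eq_of_map_eq _ (by rw [hW]; ext <;> simp [WeierstrassCurve.map])
  have hIA : integralModelInt A = ⟨1, -1, 0, -338, 1357⟩ :=
    integralModelInt_eq_of_map_eq _ (by rw [hA]; ext <;> simp [WeierstrassCurve.map])
  have hΔ : (⟨1, -1, 0, -232717, 2826984⟩ : WeierstrassCurve ℤ).Δ = discOf [1, -1, 0, -232717, 2826984] :=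
    intCurve_Δ 1 (-1) 0 (-232717) 2826984
  have hc₄ : (⟨1, -1, 0, -232717, 2826984⟩ : WeierstrassCurve ℤ).c₄ = c4Of [1, -1, 0, -232717, 2826984] :=
    intCurve_c₄ 1 (-1) 0 (-232717) 2826984
  have hΔA : (⟨1, -1, 0, -338, 1357⟩ : WeierstrassCurve ℤ).Δ = discOf [1, -1, 0, -338, 1357] :=
    intCurve_Δ 1 (-1) 0 (-338) 1357
  have hgood : W.HasGoodReductionAtPrime 3 :=
    hasGoodReductionAtPrime_of_not_dvd W 3 (by rw [minimalDiscriminantInt_eq hIW, hΔ]; decide +kernel)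
  have hgoodA : A.HasGoodReductionAtPrime 3 :=
    hasGoodReductionAtPrime_of_not_dvd A 3 (by rw [minimalDiscriminantInt_eq hIA, hΔA]; decide +kernel)
  have hap : W.frobeniusTrace 3 = 0 := by rw [frobeniusTrace_eq hIW card_u158711b1_3]; norm_num
  have hapA : A.frobeniusTrace 3 = 0 := by rw [frobeniusTrace_eq hIA card_u8477b1_3]; norm_num
  -- X7: good supersingular at 3 and additive at 7
  have hX : ClassX7 W 3 :=
    ⟨⟨hgood, by rw [hap]; exact dvd_zero _⟩, not_semistable_of_intModel hIW 7 (by norm_num) (by rw [hΔ]; decide +kernel)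
      (by rw [hc₄]; decide +kernel)⟩
  -- small image: `Δ(W)` is a rational cube, so `ρ̄_{W,3}` is not onto (Serre 1972 §5.3)
  have hcube : W.Δ = ((929593 : ℚ)) ^ 3 := by
    subst hW; norm_num [WeierstrassCurve.Δ, WeierstrassCurve.b₂, WeierstrassCurve.b₄, WeierstrassCurve.b₆, WeierstrassCurve.b₈]
  have hs : ¬ Surj W 3 := fun hsW ↦
    Literature.NumberTheory.EllipticCurves.ModThreeImage.not_hasSurjectiveModNGaloisRep_three_of_Δ_eq_cube W hcube
      (by exact_mod_cast hsW)
  -- the 3-congruence `W[3] ≃ A[3]` (Fisher), kernel-checked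
  have hc4 : W.c₄ = (11170425 : ℚ) := by
    subst hW; norm_num [WeierstrassCurve.c₄, WeierstrassCurve.b₂, WeierstrassCurve.b₄]
  have hc6 : W.c₆ = (-2392247277 : ℚ) := by
    subst hW; norm_num [WeierstrassCurve.c₆, WeierstrassCurve.b₂, WeierstrassCurve.b₄, WeierstrassCurve.b₆]
  have hc4A : A.c₄ = (16233 : ℚ) := by
    subst hA; norm_num [WeierstrassCurve.c₄, WeierstrassCurve.b₂, WeierstrassCurve.b₄]
  have hc6A : A.c₆ = (-1099413 : ℚ) := by
    subst hA; norm_num [WeierstrassCurve.c₆, WeierstrassCurve.b₂, WeierstrassCurve.b₄, WeierstrassCurve.b₆]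
  have hiso := threeCongruent_of_dualHesseCertificate_unconditional A W ((1261 : ℚ) / 33) 1 ((1 : ℚ) / 693)
    (by norm_num) (by rw [hc4A, hc6A, hc4, eval_hesseD3]; norm_num)
    (by rw [hc4A, hc6A, hc6, eval_hesseC6three]; norm_num)
  exact forall_kobayashiLowerDivisibility_three_of_unitCurvePartner W A 3 rfl hJ h12 h41 h5 h3 hD hC hS hmod hKim hV
    hX hap hs hgoodA hapA hiso htA (by norm_num) (by rw [show (2 : ℚ) = ((2 : ℕ) : ℚ) by norm_num, padicValRat.of_nat, Nat.cast_eq_zero]; exact padicValNat.eq_zero_of_not_dvd (by norm_num))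

/-- **Crux L's body at `421645e1 @ 3` FROM PRINT + ONE `L`-VALUE** (Cremona model `[1, -1, 0, -456519044, 3754602721183]`, `N = 421645 = 5·7²·1721`, X7 (additive at `7`),
`a_3 = 0`, mod-3 image `3Nn` (`Δ` a cube), rank `0`, `∏c = 54`, NO CM elliptic-curve partner — tier T2 of the LEAD's census):
`∀ ε, KobayashiLowerDivisibility W 3 ε` from ELEVEN published named facts by `forall_kobayashiLowerDivisibility_three_of_unitCurvePartner` at
the UNIT partner `A = 8477b1` (`[1, -1, 0, -338, 1357]`, `N_A = 7²·173`, good supersingular at `3`, `a_3 = 0`), whose `L`-value datum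
`L(A,1)/Ω_A = 2` (Cremona `allbsd` row `8477 b 1`: rank `0`, `#tors = 1`, `∏c = 2`, `#Ш_an = 1.000`) is the ONE displayed non-kernel input
(`htA`); the `3`-congruence `W[3] ≃ A[3]` is k3-c4's kernel certificate (member `((-9191) / 27)` of Fisher's Hesse pencil `X_A(3)`, scaling
`u = (346) / 27`; `threeCongruent_of_hesseCertificate_unconditional`, identity by `norm_num`). Kernel-decided: `3 ∤ Δ` (both), `#Ẽ(𝔽₃) = 4` (both), `7 ∣ Δ, c₄`
(additive ⇒ X7), `Δ(W) = (-73787875)³` (⇒ `¬ Surj W 3`). NO Pollack–Rubin, NO descent line, NO `BSD(E,3)`, NO preprint. Per pair;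
CONDITIONAL on print; nothing booked. [cite: Kobayashi2003, Conjecture (p. 2), (3.6), Thm. 7.4 (p. 13)] [cite: Fisher2012Hessian, Thm. 13.2 and §13]
[cite: Cremona2006, Table 1 (Cremona labels 421645e1, 8477b1)] [cite: Serre1972, §5.3] [cite: SilvermanAEC2009, VII.5 Prop. 5.1(c)] -/
theorem forall_kobayashiLowerDivisibility_u421645e1_3_of_unitPartner
    (hJ : thm62_63_73_signedColemanKato_zetaJoint) (h12 : thm12_signedSelmerDual_finite_torsion)
    (h41 : thm41_signedCharIdeal_divisibility)
    (h5 : realPeriodRat_eq_unit_mul_plusPeriod) (h3 : realPeriodRat_eq_unit_mul_plusPeriod_three)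
    (hD : Hida2000_thm326_exists_galoisRep) (hC : Carayol1986_artinConductorExponent)
    (hS : ∀ (V : WeierstrassCurve ℚ) (ℓ : ℕ) [Fact ℓ.Prime],
      V.swanConductorAt_rationalTate_eq_wildConductorExponent_of_ringChar_eq_two ℓ)
    (hmod : exists_isNewformOf)
    (hKim : BDKim2009.cor213_signedLambda_add_sum_delta_eq_of_torsionIso) (hV : vatsal1999_plusSymbol_congruence)
    (W A : WeierstrassCurve ℚ) [W.IsElliptic] [W.IsGloballyMinimal] [A.IsElliptic] [A.IsGloballyMinimal]
    [Fact (Nat.Prime 3)] (hW : W = ⟨1, -1, 0, -456519044, 3754602721183⟩) (hA : A = ⟨1, -1, 0, -338, 1357⟩)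
    (htA : A.entireLFunction 1 / (A.realPeriodRat : ℂ) = ((2 : ℚ) : ℂ)) :
    ∀ ε : ℤˣ, KobayashiLowerDivisibility W 3 ε := by
  have hIW : integralModelInt W = ⟨1, -1, 0, -456519044, 3754602721183⟩ :=
    integralModelInt_eq_of_map_eq _ (by rw [hW]; ext <;> simp [WeierstrassCurve.map])
  have hIA : integralModelInt A = ⟨1, -1, 0, -338, 1357⟩ :=
    integralModelInt_eq_of_map_eq _ (by rw [hA]; ext <;> simp [WeierstrassCurve.map])
  have hΔ : (⟨1, -1, 0, -456519044, 3754602721183⟩ : WeierstrassCurve ℤ).Δ = discOf [1, -1, 0, -456519044, 3754602721183] :=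
    intCurve_Δ 1 (-1) 0 (-456519044) 3754602721183
  have hc₄ : (⟨1, -1, 0, -456519044, 3754602721183⟩ : WeierstrassCurve ℤ).c₄ = c4Of [1, -1, 0, -456519044, 3754602721183] :=
    intCurve_c₄ 1 (-1) 0 (-456519044) 3754602721183
  have hΔA : (⟨1, -1, 0, -338, 1357⟩ : WeierstrassCurve ℤ).Δ = discOf [1, -1, 0, -338, 1357] :=
    intCurve_Δ 1 (-1) 0 (-338) 1357
  have hgood : W.HasGoodReductionAtPrime 3 :=
    hasGoodReductionAtPrime_of_not_dvd W 3 (by rw [minimalDiscriminantInt_eq hIW, hΔ]; decide +kernel)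
  have hgoodA : A.HasGoodReductionAtPrime 3 :=
    hasGoodReductionAtPrime_of_not_dvd A 3 (by rw [minimalDiscriminantInt_eq hIA, hΔA]; decide +kernel)
  have hap : W.frobeniusTrace 3 = 0 := by rw [frobeniusTrace_eq hIW card_u421645e1_3]; norm_num
  have hapA : A.frobeniusTrace 3 = 0 := by rw [frobeniusTrace_eq hIA card_u8477b1_3]; norm_num
  -- X7: good supersingular at 3 and additive at 7
  have hX : ClassX7 W 3 :=
    ⟨⟨hgood, by rw [hap]; exact dvd_zero _⟩, not_semistable_of_intModel hIW 7 (by norm_num) (by rw [hΔ]; decide +kernel)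
      (by rw [hc₄]; decide +kernel)⟩
  -- small image: `Δ(W)` is a rational cube, so `ρ̄_{W,3}` is not onto (Serre 1972 §5.3)
  have hcube : W.Δ = ((-73787875 : ℚ)) ^ 3 := by
    subst hW; norm_num [WeierstrassCurve.Δ, WeierstrassCurve.b₂, WeierstrassCurve.b₄, WeierstrassCurve.b₆, WeierstrassCurve.b₈]
  have hs : ¬ Surj W 3 := fun hsW ↦
    Literature.NumberTheory.EllipticCurves.ModThreeImage.not_hasSurjectiveModNGaloisRep_three_of_Δ_eq_cube W hcube
      (by exact_mod_cast hsW)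
  -- the 3-congruence `W[3] ≃ A[3]` (Fisher), kernel-checked
  have hc4 : W.c₄ = (21912914121 : ℚ) := by
    subst hW; norm_num [WeierstrassCurve.c₄, WeierstrassCurve.b₂, WeierstrassCurve.b₄]
  have hc6 : W.c₆ = (-3243878142988581 : ℚ) := by
    subst hW; norm_num [WeierstrassCurve.c₆, WeierstrassCurve.b₂, WeierstrassCurve.b₄, WeierstrassCurve.b₆]
  have hc4A : A.c₄ = (16233 : ℚ) := by
    subst hA; norm_num [WeierstrassCurve.c₄, WeierstrassCurve.b₂, WeierstrassCurve.b₄]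
  have hc6A : A.c₆ = (-1099413 : ℚ) := by
    subst hA; norm_num [WeierstrassCurve.c₆, WeierstrassCurve.b₂, WeierstrassCurve.b₄, WeierstrassCurve.b₆]
  have hiso := threeCongruent_of_hesseCertificate_unconditional A W ((-9191 : ℚ) / 27) 1 ((346 : ℚ) / 27)
    (by norm_num) (by rw [hc4A, hc6A, hc4, eval_hesseC4three]; norm_num)
    (by rw [hc4A, hc6A, hc6, eval_hesseC6three]; norm_num)
  exact forall_kobayashiLowerDivisibility_three_of_unitCurvePartner W A 3 rfl hJ h12 h41 h5 h3 hD hC hS hmod hKim hV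
    hX hap hs hgoodA hapA hiso htA (by norm_num) (by rw [show (2 : ℚ) = ((2 : ℕ) : ℚ) by norm_num, padicValRat.of_nat, Nat.cast_eq_zero]; exact padicValNat.eq_zero_of_not_dvd (by norm_num))

/-- **Crux L's body at the SELF-UNIT pair `126350bb1 @ 3` FROM PRINT + ONE `L`-VALUE** (Cremona model `[1, -1, 0, 37233653, 420287217861]`, `N = 126350 = 2·5²·7·19²`,
X7 (additive at `19`), `a_3 = 0`, mod-3 image `3Nn` (`Δ` a cube), rank `0`, `#tors = 2`, `∏c = 16`, `#Ш_an = 4`, so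
`L(E,1)/Ω_E = 16` — a `3`-adic unit; NO CM elliptic-curve partner — tier T2 of the LEAD's census): `∀ ε, KobayashiLowerDivisibility W 3 ε`
from ELEVEN published named facts by `forall_kobayashiLowerDivisibility_three_of_unitCurvePartner` with the DEGENERATE partner `A = W`
(identity on `W[3]`); the ONE displayed non-kernel input is the `L`-value datum `htW` (Cremona `allbsd` row `126350 bb 1`). Kernel-decided:
`3 ∤ Δ`, `#Ẽ(𝔽₃) = 4`, `19 ∣ Δ, c₄` (additive ⇒ X7), `Δ(W) = (-430196480)³` (⇒ `¬ Surj W 3`). NO descent line, NO `BSD(E,3)`, NO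
B. D. Kim 2013, NO preprint (compare k3-c4's `kobayashiMainConjecture_u126350bb1_3_of_selmerTrivial_of_bsdp`, which displays an exact
`3`-descent line and `3 ∤ ∏c`). Per pair; CONDITIONAL on print; nothing booked.
[cite: Kobayashi2003, Conjecture (p. 2), (3.6), Thm. 7.4 (p. 13)] [cite: Cremona2006, Table 1 (Cremona label 126350bb1)] [cite: Serre1972, §5.3]
[cite: SilvermanAEC2009, VII.5 Prop. 5.1(c)] -/
theorem forall_kobayashiLowerDivisibility_u126350bb1_3_of_selfUnit
    (hJ : thm62_63_73_signedColemanKato_zetaJoint) (h12 : thm12_signedSelmerDual_finite_torsion)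
    (h41 : thm41_signedCharIdeal_divisibility)
    (h5 : realPeriodRat_eq_unit_mul_plusPeriod) (h3 : realPeriodRat_eq_unit_mul_plusPeriod_three)
    (hD : Hida2000_thm326_exists_galoisRep) (hC : Carayol1986_artinConductorExponent)
    (hS : ∀ (V : WeierstrassCurve ℚ) (ℓ : ℕ) [Fact ℓ.Prime],
      V.swanConductorAt_rationalTate_eq_wildConductorExponent_of_ringChar_eq_two ℓ)
    (hmod : exists_isNewformOf)
    (hKim : BDKim2009.cor213_signedLambda_add_sum_delta_eq_of_torsionIso) (hV : vatsal1999_plusSymbol_congruence)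
    (W : WeierstrassCurve ℚ) [W.IsElliptic] [W.IsGloballyMinimal]
    [Fact (Nat.Prime 3)] (hW : W = ⟨1, -1, 0, 37233653, 420287217861⟩)
    (htW : W.entireLFunction 1 / (W.realPeriodRat : ℂ) = ((16 : ℚ) : ℂ)) :
    ∀ ε : ℤˣ, KobayashiLowerDivisibility W 3 ε := by
  have hIW : integralModelInt W = ⟨1, -1, 0, 37233653, 420287217861⟩ :=
    integralModelInt_eq_of_map_eq _ (by rw [hW]; ext <;> simp [WeierstrassCurve.map])
  have hΔ : (⟨1, -1, 0, 37233653, 420287217861⟩ : WeierstrassCurve ℤ).Δ = discOf [1, -1, 0, 37233653, 420287217861] :=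
    intCurve_Δ 1 (-1) 0 37233653 420287217861
  have hc₄ : (⟨1, -1, 0, 37233653, 420287217861⟩ : WeierstrassCurve ℤ).c₄ = c4Of [1, -1, 0, 37233653, 420287217861] :=
    intCurve_c₄ 1 (-1) 0 37233653 420287217861
  have hgood : W.HasGoodReductionAtPrime 3 :=
    hasGoodReductionAtPrime_of_not_dvd W 3 (by rw [minimalDiscriminantInt_eq hIW, hΔ]; decide +kernel)
  have hap : W.frobeniusTrace 3 = 0 := by rw [frobeniusTrace_eq hIW card_u126350bb1_3]; norm_num
  -- X7: good supersingular at 3 and additive at 19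
  have hX : ClassX7 W 3 :=
    ⟨⟨hgood, by rw [hap]; exact dvd_zero _⟩, not_semistable_of_intModel hIW 19 (by norm_num) (by rw [hΔ]; decide +kernel)
      (by rw [hc₄]; decide +kernel)⟩
  -- small image: `Δ(W)` is a rational cube
  have hcube : W.Δ = ((-430196480 : ℚ)) ^ 3 := by
    subst hW; norm_num [WeierstrassCurve.Δ, WeierstrassCurve.b₂, WeierstrassCurve.b₄, WeierstrassCurve.b₆, WeierstrassCurve.b₈]
  have hs : ¬ Surj W 3 := fun hsW ↦
    Literature.NumberTheory.EllipticCurves.ModThreeImage.not_hasSurjectiveModNGaloisRep_three_of_Δ_eq_cube W hcube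
      (by exact_mod_cast hsW)
  -- the degenerate partner: the identity `W[3] ≃ W[3]`
  have hiso : ∃ e : geomTorsion W ((3 : ℕ) : ℤ) ≃+ geomTorsion W ((3 : ℕ) : ℤ),
      ∀ (σ : Field.absoluteGaloisGroup ℚ) (P : geomTorsion W ((3 : ℕ) : ℤ)), e (σ • P) = σ • e P :=
    ⟨AddEquiv.refl _, fun _ _ ↦ rfl⟩
  exact forall_kobayashiLowerDivisibility_three_of_unitCurvePartner W W 3 rfl hJ h12 h41 h5 h3 hD hC hS hmod hKim hV
    hX hap hs hgood hap hiso htW (by norm_num) (by rw [show (16 : ℚ) = ((16 : ℕ) : ℚ) by norm_num, padicValRat.of_nat, Nat.cast_eq_zero]; exact padicValNat.eq_zero_of_not_dvd (by norm_num))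

end Summit.BirchSwinnertonDyer.BirchSwinnertonDyer.Theorems.SmallImageRttOneSided

end
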